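import Mathlib
import Summits.BirchSwinnertonDyer.BirchSwinnertonDyer.Theorems.Rank2ObservatoryIsoLocalCheck
import Summits.BirchSwinnertonDyer.BirchSwinnertonDyer.Theorems.Rank2ObservatoryIsoLocalBridge
import Summits.BirchSwinnertonDyer.BirchSwinnertonDyer.Theorems.Rank2ObservatoryIsoSelmerBound
import Summits.BirchSwinnertonDyer.BirchSwinnertonDyer.Theorems.Rank2ObservatoryIsoClassLower

/-!
# Rank-2 observatory — KERNEL-ISO certificate interface: `rank E_{a,b}(ℚ) = r` by descent via `2`-isogeny

HONEST FRAMING: per-curve certified theorems and census instruments; no claim on BSD in rank ≥ 2.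

The per-curve interface of the descent via `2`-isogeny (Silverman–Tate §3.6, Cremona §3.6 Method 1) for
`E_{a,b} : y² = x³ + a x² + b x` (one rational `2`-torsion point moved to `(0,0)`), `E' = E_{-2a, a²-4b}`,
assembling (A) `Rank2ObservatoryIsoLocalCheck` + (B) `Rank2ObservatoryIsoLocalBridge` (certified `p`-adic
insolubility of `w² = d u⁴ + a u²z² + d′ z⁴`), (C1) `Rank2ObservatoryIsoSelmerBound` (rank upper bound from
Selmer supersets) and (C2) `Rank2ObservatoryIsoClassLower` (rank lower bound from exhibited `α`-classes):

* `not_isSoluble_of_quarticCheck` / `not_isLocallySoluble_of_quarticCheck` — (A)+(B) glued;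
* `not_isSoluble_real_twoIsogenyQuartic_of_discr` — the negative definite real kill (`d < 0`, `a² < 4dd′`);
* `killOne` / `killCheck` / `killCheck_sound` — a kernel-decidable KILL CHECKER: every signed squarefree
  candidate `d` of `S(a,b)` is in the claimed list `D` or carries a certificate `(d, kind, p, fuel)`:
  kind `0` all coefficients non-positive, kind `1` negative definite, kind `≥ 2` the `p`-adic search;
* `mordellWeilRank_eq_of_certificate` — UPPER (`S(a,b) ⊆ D₁`, `S(a',b') ⊆ D₂`, `log₂ #D₁ + log₂ #D₂ ≤ r+2`)
  and LOWER (certified-distinct class lists `L₁ ⊆ α(E(ℚ))`, `L₂ ⊆ ᾱ(E'(ℚ))`, `2^(r+1) < |L₁|·|L₂|`)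
  ⇒ `rank = r`. Every per-curve obligation is `decide`, `norm_num`, `simp` (the `Nat.primeFactorsList`
  simproc) or a one-line lemma application; nothing depends on an enumeration order.

## References
* J. H. Silverman, J. Tate, *Rational Points on Elliptic Curves*, 2nd ed. (2015), §3.6. [cite: SilvermanTate2015, §3.6]
* J. E. Cremona, *Algorithms for Modular Elliptic Curves*, 2nd ed. (1997), §3.6 (`Qp_soluble`, `Zp_soluble`;
  Method 1). [cite: CremonaAlgorithms1997, §3.6 (Method 1)]
-/

set_option linter.dupNamespace false

namespace Summit.BirchSwinnertonDyer.BirchSwinnertonDyer.Rank2Observatory.IsoLocal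

open Literature.NumberTheory.EllipticCurves

/-- **`quarticCheck p d a d′ fuel = true` ⇒ the homogeneous space `w² = d u⁴ + a u²z² + d′ z⁴` has no
`ℚ_p`-point.** [cite: CremonaAlgorithms1997, §3.6 (Qp_soluble, Zp_soluble)] -/
theorem not_isSoluble_of_quarticCheck (p : ℕ) [Fact p.Prime] (d a d' : ℤ) (f : ℕ)
    (h : quarticCheck p d a d' f = true) :
    ¬ ((twoIsogenyQuartic a d d').map (Int.castRingHom ℚ_[p])).IsSoluble := by
  obtain ⟨K, h₁, h₂⟩ := quarticCheck_sound h
  exact not_isSoluble_of_congr_obstruction K h₁ h₂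

/-- Hence the form is not locally soluble, so `d ∉ S(a, d d′)`. [cite: CremonaAlgorithms1997, §3.6 (Qp_soluble, Zp_soluble)] -/
theorem not_isLocallySoluble_of_quarticCheck (p : ℕ) [Fact p.Prime] (d a d' : ℤ) (f : ℕ)
    (h : quarticCheck p d a d' f = true) : ¬ (twoIsogenyQuartic a d d').IsLocallySoluble :=
  fun hl => not_isSoluble_of_quarticCheck p d a d' f h (hl.2 p)

/-- **Real kill, negative definite case**: `d < 0`, `a² < 4 d d′` ⇒ no real point
(`4d · (d X² + a X Y + d′ Y²) = (2dX + aY)² + (4dd′ - a²) Y²`). [cite: CremonaAlgorithms1997, §3.6 (Method 1)] -/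
theorem not_isSoluble_real_twoIsogenyQuartic_of_discr {a d d' : ℤ} (hd : d < 0)
    (hdisc : a ^ 2 < 4 * d * d') : ¬ ((twoIsogenyQuartic a d d').map (Int.castRingHom ℝ)).IsSoluble := by
  rintro ⟨u, z, w, h0, h⟩
  rw [eval_map_twoIsogenyQuartic] at h
  simp only [eq_intCast] at h
  have hd₁ : (d : ℝ) < 0 := by exact_mod_cast hd
  have hc : ((a : ℝ)) ^ 2 < 4 * d * d' := by exact_mod_cast hdisc
  have key : 4 * (d : ℝ) * (d * u ^ 4 + a * u ^ 2 * z ^ 2 + d' * z ^ 4) =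
      (2 * d * u ^ 2 + a * z ^ 2) ^ 2 + (4 * d * d' - a ^ 2) * (z ^ 2) ^ 2 := by ring
  have hS := sq_nonneg (2 * (d : ℝ) * u ^ 2 + a * z ^ 2)
  have hZ := sq_nonneg ((z : ℝ) ^ 2)
  have hw := sq_nonneg w
  have hV0 : (d : ℝ) * u ^ 4 + a * u ^ 2 * z ^ 2 + d' * z ^ 4 = 0 := by
    by_contra hne
    have hpos : 0 < (d : ℝ) * u ^ 4 + a * u ^ 2 * z ^ 2 + d' * z ^ 4 :=
      lt_of_le_of_ne (h ▸ hw) (Ne.symm hne)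
    nlinarith
  have h4 : (2 * (d : ℝ) * u ^ 2 + a * z ^ 2) ^ 2 + (4 * d * d' - a ^ 2) * (z ^ 2) ^ 2 = 0 := by
    rw [← key, hV0, mul_zero]
  have hcpos : (0 : ℝ) < 4 * d * d' - a ^ 2 := by linarith
  have hz4 : ((z : ℝ) ^ 2) ^ 2 = 0 := by
    by_contra hne
    have hzp : 0 < ((z : ℝ) ^ 2) ^ 2 := lt_of_le_of_ne hZ (Ne.symm hne)
    nlinarith [mul_pos hcpos hzp]
  have hz2 : (z : ℝ) ^ 2 = 0 := pow_eq_zero_iff (n := 2) two_ne_zero |>.mp hz4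
  have hz : z = 0 := pow_eq_zero_iff (n := 2) (by norm_num) |>.mp hz2
  subst hz
  have hu4 : (d : ℝ) * u ^ 4 = 0 := by simpa using hV0
  have hu : u = 0 := by
    rcases mul_eq_zero.mp hu4 with h1 | h1
    · exact absurd h1 hd₁.ne
    · exact pow_eq_zero_iff (n := 4) (by norm_num) |>.mp h1
  exact h0.elim (fun h1 => h1 hu) (fun h1 => h1 rfl)

/-! ### (C4) The kill checker -/

/-- Validate the kill certificate `c = (kind, p, fuel)` for the candidate `d` of `S(a, b)`. [folklore] -/
def killOne (a b d : ℤ) (c : ℕ × ℕ × ℕ) : Bool :=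
  match c with
  | (0, _, _) => decide (d < 0) && decide (b / d < 0) && decide (a ≤ 0)
  | (1, _, _) => decide (d < 0) && decide (a ^ 2 < 4 * d * (b / d))
  | (_ + 2, p, f) => quarticCheck p d a (b / d) f

/-- **The kill checker**: every signed squarefree candidate is in `D` or carries a validating certificate
(an entry `(d, kind, p, fuel)` of `certs`). [folklore] -/
def killCheck (a b : ℤ) (D : List ℤ) (certs : List (ℤ × (ℕ × ℕ × ℕ))) (l : List ℕ) : Bool :=
  (signedSqfreeProds l).all fun d =>
    D.contains d || certs.any fun c => (c.1 == d) && killOne a b d c.2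

/-- Soundness of one certificate. [cite: CremonaAlgorithms1997, §3.6 (Method 1)] -/
theorem killOne_sound {a b d : ℤ} :
    ∀ {c : ℕ × ℕ × ℕ}, (2 ≤ c.1 → c.2.1.Prime) → killOne a b d c = true →
      ¬ (twoIsogenyQuartic a d (b / d)).IsLocallySoluble
  | (0, _, _), _, h => by
      simp only [killOne, Bool.and_eq_true, decide_eq_true_eq] at h
      exact fun hl => not_isSoluble_real_twoIsogenyQuartic_of_neg h.1.1 h.1.2 h.2 hl.1
  | (1, _, _), _, h => by
      simp only [killOne, Bool.and_eq_true, decide_eq_true_eq] at h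
      exact fun hl => not_isSoluble_real_twoIsogenyQuartic_of_discr h.1 h.2 hl.1
  | (_ + 2, p, f), hp, h => by
      simp only [killOne] at h
      haveI : Fact p.Prime := ⟨hp (by simp)⟩
      exact not_isLocallySoluble_of_quarticCheck p d a (b / d) f h

/-- **Soundness of the kill checker**: with the primes of the `p`-adic certificates prime,
`killCheck a b D certs l = true` gives the hypothesis `hkill` of `IsoLocal.mordellWeilRank_eq_of_certificate`
for `D.toFinset`. [cite: CremonaAlgorithms1997, §3.6 (Method 1)] -/
theorem killCheck_sound {a b : ℤ} {D : List ℤ} {certs : List (ℤ × (ℕ × ℕ × ℕ))} {l : List ℕ}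
    (hP : ∀ c ∈ certs, 2 ≤ c.2.1 → c.2.2.1.Prime) (h : killCheck a b D certs l = true) :
    ∀ d ∈ signedSqfreeProds l, d ∉ D.toFinset → ¬ (twoIsogenyQuartic a d (b / d)).IsLocallySoluble := by
  intro d hd hD
  simp only [killCheck, List.all_eq_true, Bool.or_eq_true, List.any_eq_true, Bool.and_eq_true,
    beq_iff_eq] at h
  rcases h d hd with h1 | ⟨c, hc, hcd, hk⟩
  · exact absurd (List.mem_toFinset.mpr (List.contains_iff_mem.mp h1)) hD
  · subst hcd
    exact killOne_sound (hP c hc) hk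

/-- Sanity check (census row `1443c1`, `a = 17`, `b = -48`): the candidates `±2, ±6` die `2`-adically,
`S(17, -48) ⊆ {1, -1, 3, -3}`. [cite: CremonaAlgorithms1997, §3.6 (Method 1)] -/
example : killCheck 17 (-48) [1, -1, 3, -3]
    [(2, (2, 2, 9)), (6, (2, 2, 9)), (-2, (2, 2, 9)), (-6, (2, 2, 9))] [2, 3] = true := by
  decide


open Literature.NumberTheory.EllipticCurves WeierstrassCurve
open WeierstrassCurve.Affine (sqClass)

/-- `¬` locally soluble from a real kill. [folklore] -/
theorem not_isLocallySoluble_of_real {a d d' : ℤ}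
    (h : ¬ ((twoIsogenyQuartic a d d').map (Int.castRingHom ℝ)).IsSoluble) :
    ¬ (twoIsogenyQuartic a d d').IsLocallySoluble := fun hl => h hl.1

/-- `[1] ∈ α(Γ)` in the integer-cast form used by the certificates. [folklore] -/
theorem sqClass_intCast_one_mem_range {F : Type*} [Field F] (W : WeierstrassCurve F) :
    sqClass ((1 : ℤ) : F) ∈ Set.range W.xSqClass := by
  have h : sqClass ((1 : ℤ) : F) = 1 := by simpa using WeierstrassCurve.Affine.sqClass_mul_self (1 : F)
  rw [h]
  exact one_mem_range W

/-- The class of a rational `x = N / D` (`N, D ≠ 0`) is `[N D]`. [folklore] -/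
theorem sqClass_div_eq_sqClass_mul {N D : ℚ} (hN : N ≠ 0) (hD : D ≠ 0) :
    sqClass (N / D) = sqClass (N * D) := by
  rw [show N / D = N * D / D ^ 2 by field_simp]
  exact sqClass_div_sq (mul_ne_zero hN hD) hD

/-- When no candidate needs killing: `D = (signedSqfreeProds l).toFinset`. [folklore] -/
theorem kill_none {a b : ℤ} (l : List ℕ) :
    ∀ d ∈ signedSqfreeProds l, d ∉ (signedSqfreeProds l).toFinset →
      ¬ (twoIsogenyQuartic a d (b / d)).IsLocallySoluble :=
  fun _ hd hD => absurd (List.mem_toFinset.mpr hd) hD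

/-- **`rank E_{a,b}(ℚ) = r` from an explicit `2`-isogeny descent certificate** (see the module docstring
for the fields). [cite: SilvermanTate2015, §3.6] [cite: CremonaAlgorithms1997, §3.6 (Method 1)] -/
theorem mordellWeilRank_eq_of_certificate {a b a' b' : ℤ} (hab : b * (a ^ 2 - 4 * b) ≠ 0)
    (ha' : a' = -2 * a) (hb' : b' = a ^ 2 - 4 * b) {r : ℕ}
    (l₁ l₂ : List ℕ) (hl₁ : ∀ q : ℕ, q.Prime → q ∣ b.natAbs → q ∈ l₁)
    (hl₂ : ∀ q : ℕ, q.Prime → q ∣ b'.natAbs → q ∈ l₂) (D₁ D₂ : Finset ℤ)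
    (hkill₁ : ∀ d ∈ signedSqfreeProds l₁, d ∉ D₁ → ¬ (twoIsogenyQuartic a d (b / d)).IsLocallySoluble)
    (hkill₂ : ∀ d ∈ signedSqfreeProds l₂, d ∉ D₂ → ¬ (twoIsogenyQuartic a' d (b' / d)).IsLocallySoluble)
    (hcard : Nat.log 2 D₁.card + Nat.log 2 D₂.card ≤ r + 2)
    (L₁ L₂ : List ℤ) (Q₁ Q₂ : List ℕ) (hL₁ : (L₁.all fun n => n != 0) = true)
    (hL₂ : (L₂.all fun n => n != 0) = true) (hp₁ : pairwiseNonSquareVia Q₁ L₁ = true)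
    (hp₂ : pairwiseNonSquareVia Q₂ L₂ = true)
    (hmem₁ : ∀ n ∈ L₁, sqClass (n : ℚ) ∈
      Set.range (⟨0, (a : ℚ), 0, (b : ℚ), 0⟩ : WeierstrassCurve ℚ).xSqClass)
    (hmem₂ : ∀ n ∈ L₂, sqClass (n : ℚ) ∈
      Set.range (⟨0, (a' : ℚ), 0, (b' : ℚ), 0⟩ : WeierstrassCurve ℚ).xSqClass)
    (hlen : 2 ^ (r + 1) < L₁.length * L₂.length) :
    (⟨0, (a : ℚ), 0, (b : ℚ), 0⟩ : WeierstrassCurve ℚ).mordellWeilRank = r := by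
  subst ha' hb'
  have hb : b ≠ 0 := fun h => hab (by rw [h, zero_mul])
  have hb'0 : a ^ 2 - 4 * b ≠ 0 := fun h => hab (by rw [h, mul_zero])
  have hab' := twoIsogenyCodomain_ne_zero hab
  refine le_antisymm ?_ ?_
  · exact mordellWeilRank_le_of_selmer_subsets hab (twoIsogenySelmerGroup_subset hb l₁ hl₁ D₁ hkill₁)
      (twoIsogenySelmerGroup_subset hb'0 l₂ hl₂ D₂ hkill₂) hcard
  · have hk₁ := length_le_natCard_range_xSqClass hab L₁ Q₁ hL₁ hp₁ hmem₁
    have hk₂ := length_le_natCard_range_xSqClass hab' L₂ Q₂ hL₂ hp₂ hmem₂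
    refine le_mordellWeilRank_of_classes hab hk₁ ?_ hlen
    rw [twoIsogenyCodomain_mk_intCast]
    exact hk₂

/-! ### Sanity checks of the decidable side -/

/-- `Nat.log` obligations are kernel-decidable. [folklore] -/
example : Nat.log 2 ({1, -1, 2, -2} : Finset ℤ).card + Nat.log 2 ({1, 17, 2, 34} : Finset ℤ).card ≤ 2 + 2 := by
  decide

end Summit.BirchSwinnertonDyer.BirchSwinnertonDyer.Rank2Observatory.IsoLocal
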